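import Summits.KontsevichZagierPeriods.Zeta5Search.LaiSweepShard

/-!
# `κ₃` sweep certificate — shard file 032 of 127 (shards 224–230 of 889)

HONEST FRAMING. Systematic search; no irrationality claim unless certified. This file only checks,
by `decide +kernel`, shards 224–230 of the order-cell sweep of the `κ₃` point `(74, 2180, 444; δ74)`
(engine `LaiSweepEngine`, soundness `LaiSweepJump/Free/Eval/Shard/Kappa3`; a shard is `⟨regime, n,
p, q, p', q', Lo, Up⟩`: `n` cells from `p/q` to `p'/q'` with integer rate sums in `[Lo, Up]`, `K =
128`, `D = 2^40`). It draws NO conclusion: only the capstone `LaiKappa3SweepCert`, which needs all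
127 shard files, does. Kernel cost of this file ≈ 560 cells × 0.3 s.
-/

namespace Summit.KontsevichZagierPeriods.Zeta5Search.Sweep

set_option maxHeartbeats 100000000 in
/-- Shard 224: 80 cells of regime B from `9/55` to `46/279`.
[cite: Lai2024BallRivoal, §4 Lemma 4.3] -/
theorem shard224 :
    Shard.check 128 (2^40)
      ⟨true, 80, 9, 55, 46, 279, 38966362451005, 39667281154640⟩ = true := by
  decide +kernel

set_option maxHeartbeats 100000000 in
/-- Shard 225: 80 cells of regime B from `46/279` to `47/283`.
[cite: Lai2024BallRivoal, §4 Lemma 4.3] -/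
theorem shard225 :
    Shard.check 128 (2^40)
      ⟨true, 80, 46, 279, 47, 283, 37432791332293, 38116718464976⟩ = true := by
  decide +kernel

set_option maxHeartbeats 100000000 in
/-- Shard 226: 80 cells of regime B from `47/283` to `65/388`.
[cite: Lai2024BallRivoal, §4 Lemma 4.3] -/
theorem shard226 :
    Shard.check 128 (2^40)
      ⟨true, 80, 47, 283, 65, 388, 44567727271017, 45415818037239⟩ = true := by
  decide +kernel

set_option maxHeartbeats 100000000 in
/-- Shard 227: 80 cells of regime B from `65/388` to `68/403`.
[cite: Lai2024BallRivoal, §4 Lemma 4.3] -/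
theorem shard227 :
    Shard.check 128 (2^40)
      ⟨true, 80, 65, 388, 68, 403, 37080187501939, 37783161451049⟩ = true := by
  decide +kernel

set_option maxHeartbeats 100000000 in
/-- Shard 228: 80 cells of regime B from `68/403` to `60/353`.
[cite: Lai2024BallRivoal, §4 Lemma 4.3] -/
theorem shard228 :
    Shard.check 128 (2^40)
      ⟨true, 80, 68, 403, 60, 353, 37725442785063, 38453329846973⟩ = true := by
  decide +kernel

set_option maxHeartbeats 100000000 in
/-- Shard 229: 80 cells of regime B from `60/353` to `69/403`.
[cite: Lai2024BallRivoal, §4 Lemma 4.3] -/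
theorem shard229 :
    Shard.check 128 (2^40)
      ⟨true, 80, 60, 353, 69, 403, 37806054696930, 38548218412608⟩ = true := by
  decide +kernel

set_option maxHeartbeats 100000000 in
/-- Shard 230: 80 cells of regime B from `69/403` to `64/371`.
[cite: Lai2024BallRivoal, §4 Lemma 4.3] -/
theorem shard230 :
    Shard.check 128 (2^40)
      ⟨true, 80, 69, 403, 64, 371, 38801260608611, 39577143464334⟩ = true := by
  decide +kernel

/-- The checked shards of this file, in order. [folklore] -/
def shards032 : List (CheckedShard 128 (2^40)) :=
  [⟨_, shard224⟩, ⟨_, shard225⟩, ⟨_, shard226⟩, ⟨_, shard227⟩, ⟨_, shard228⟩,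
    ⟨_, shard229⟩, ⟨_, shard230⟩]

end Summit.KontsevichZagierPeriods.Zeta5Search.Sweep
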